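import Mathlib

/-!
# Crux `GappedShellCensus.FiveFoldRationingR` (stmt-AtomisticToContinuum-18071), line `Sketch` —
# stub `stub_ffrFoamGlue` (gluing two five-fold walks into one bi-infinite chain)

For a configuration `Y ⊆ ℝ³` at scale `a > 0` write `B = a (1 + 1/50)` and, for a site `y`, let
`FB y` be the set of FIVE-BOND partners of `y` (bond partners `v ≠ y`, `dist y v ≤ B`, with at least
five common bond partners); the FIVE-SITES `S` are the sites with a five-bond partner.  The relation
`v ∈ FB y` is symmetric.  Assume: no branching (`FB y` is empty or has exactly two elements),
non-backtracking walks along five-bonds out of every five-bond, axis uniqueness (any two five-sites are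
joined by a five-fold walk) and uniform quasi-geodesy of non-backtracking five-fold walks
(`c |i - j| ≤ dist (f i) (f j)` for one `c > 0`).  Then `S` is empty or the range of ONE chain
`z : ℤ → Y` of five-bonds with `c |i - j| ≤ dist (z i) (z j)`.

Proof: pick a five-site `y₀`; it has exactly two five-bond partners `v₀ ≠ v₁`; glue the walk out of
`(y₀, v₀)` (indices `≥ 0`) and the walk out of `(y₀, v₁)` (indices `≤ 0`) into `z : ℤ → Y`
(`ffrFG_chain`).  Every shifted tail `n ↦ z (i + n)` is a non-backtracking five-fold walk, whence the
two-sided quasi-geodesy (`ffrFG_quasi`).  Finally `z (i - 1) ≠ z (i + 1)` are two five-bond partners of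
`z i`, which has exactly two, so a five-fold walk starting on the chain never leaves it
(`ffrFG_range`); by axis uniqueness every five-site is reached by such a walk from `y₀ = z 0`.
Everything except the final instantiation is an abstract statement about a symmetric "partner" map
`FB` on a pseudo-metric space.
-/

noncomputable section

namespace Summit.AtomisticToContinuum.Crystallization.Theorems

/-- Every integer is `n` or `-(n + 1)` for a natural number `n`. [folklore] -/
theorem ffrFG_int_cases₂ (i : ℤ) : (∃ n : ℕ, i = n) ∨ ∃ n : ℕ, i = -((n : ℤ) + 1) := by
  rcases le_or_gt 0 i with h | h
  · exact Or.inl ⟨i.toNat, (Int.toNat_of_nonneg h).symm⟩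
  · exact Or.inr ⟨(-i - 1).toNat, by omega⟩

/-- Every integer is `n`, `-1` or `-(n + 2)` for a natural number `n`. [folklore] -/
theorem ffrFG_int_cases₃ (i : ℤ) :
    (∃ n : ℕ, i = n) ∨ i = -1 ∨ ∃ n : ℕ, i = -((n : ℤ) + 2) := by
  rcases le_or_gt 0 i with h | h
  · exact Or.inl ⟨i.toNat, (Int.toNat_of_nonneg h).symm⟩
  · rcases eq_or_ne i (-1) with h1 | h1
    · exact Or.inr (Or.inl h1)
    · exact Or.inr (Or.inr ⟨(-i - 2).toNat, by omega⟩)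

/-- **Gluing.** For a partner map `FB` which is symmetric on `Y`, two non-backtracking `FB`-walks
`fp`, `fm` in `Y` with the same origin and different first steps glue into a bi-infinite
non-backtracking `FB`-chain `z` (`z n = fp n`, `z (-n) = fm n`). [folklore] -/
theorem ffrFG_chain {E : Type*} (Y : Set E) (FB : E → Set E)
    (hsymm : ∀ y ∈ Y, ∀ v, v ∈ FB y → y ∈ FB v) {fp fm : ℕ → E} (h0 : fp 0 = fm 0)
    (h1 : fp 1 ≠ fm 1) (hpY : ∀ n, fp n ∈ Y) (hpS : ∀ n, fp (n + 1) ∈ FB (fp n))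
    (hpB : ∀ n, fp (n + 2) ≠ fp n) (hmY : ∀ n, fm n ∈ Y) (hmS : ∀ n, fm (n + 1) ∈ FB (fm n))
    (hmB : ∀ n, fm (n + 2) ≠ fm n) :
    ∃ z : ℤ → E, z 0 = fp 0 ∧ (∀ i, z i ∈ Y) ∧ (∀ i, z (i + 1) ∈ FB (z i)) ∧
      ∀ i, z (i + 2) ≠ z i := by
  obtain ⟨z, Z1, Z2⟩ : ∃ z : ℤ → E, (∀ n : ℕ, z n = fp n) ∧ ∀ n : ℕ, z (-(n : ℤ)) = fm n := by
    refine ⟨fun i => if 0 ≤ i then fp i.toNat else fm (-i).toNat, fun n => by simp, fun n => ?_⟩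
    cases n with
    | zero => simp [h0]
    | succ m =>
      have hlt : ¬ (0 : ℤ) ≤ -((m + 1 : ℕ) : ℤ) := by omega
      simp only [hlt, if_false, neg_neg, Int.toNat_natCast]
  -- values of `z` at the index shapes produced by `ffrFG_int_cases₂/₃`
  have A1 : ∀ n : ℕ, z ((n : ℤ) + 1) = fp (n + 1) := fun n => by exact_mod_cast Z1 (n + 1)
  have A2 : ∀ n : ℕ, z ((n : ℤ) + 2) = fp (n + 2) := fun n => by exact_mod_cast Z1 (n + 2)
  have A3 : ∀ n : ℕ, z (-((n : ℤ) + 1)) = fm (n + 1) := fun n => by exact_mod_cast Z2 (n + 1)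
  have A4 : ∀ n : ℕ, z (-((n : ℤ) + 2)) = fm (n + 2) := fun n => by exact_mod_cast Z2 (n + 2)
  have J1 : z 1 = fp 1 := by exact_mod_cast Z1 1
  have J2 : z (-1) = fm 1 := by exact_mod_cast Z2 1
  refine ⟨z, by exact_mod_cast Z1 0, fun i => ?_, fun i => ?_, fun i => ?_⟩
  · -- the chain lies in `Y`
    obtain ⟨n, rfl⟩ | ⟨n, rfl⟩ := ffrFG_int_cases₂ i
    · rw [Z1]
      exact hpY n
    · rw [A3]
      exact hmY (n + 1)
  · -- forward steps are partner steps
    obtain ⟨n, rfl⟩ | ⟨n, rfl⟩ := ffrFG_int_cases₂ i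
    · rw [Z1, A1]
      exact hpS n
    · rw [A3, show (-((n : ℤ) + 1) + 1) = -(n : ℤ) by ring, Z2]
      exact hsymm _ (hmY n) _ (hmS n)
  · -- no backtracking (at the junction: `z 1 = fp 1 ≠ fm 1 = z (-1)`)
    obtain ⟨n, rfl⟩ | rfl | ⟨n, rfl⟩ := ffrFG_int_cases₃ i
    · rw [Z1, A2]
      exact hpB n
    · rw [show (-1 + 2 : ℤ) = 1 by norm_num, J1, J2]
      exact h1
    · rw [A4, show (-((n : ℤ) + 2) + 2) = -(n : ℤ) by ring, Z2]
      exact (hmB n).symm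

/-- **Two-sided quasi-geodesy.** If all non-backtracking `FB`-walks in `Y` satisfy
`c |i - j| ≤ dist (f i) (f j)`, then so does every bi-infinite non-backtracking `FB`-chain (apply the
hypothesis to the shifted tails `n ↦ z (i + n)`). [folklore] -/
theorem ffrFG_quasi {E : Type*} [PseudoMetricSpace E] (Y : Set E) (FB : E → Set E) {c : ℝ}
    (hQ : ∀ f : ℕ → E, (∀ n, f n ∈ Y) → (∀ n, f (n + 1) ∈ FB (f n)) → (∀ n, f (n + 2) ≠ f n) →
      ∀ i j : ℕ, c * |((i : ℝ) - j)| ≤ dist (f i) (f j))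
    {z : ℤ → E} (hY : ∀ i, z i ∈ Y) (hS : ∀ i, z (i + 1) ∈ FB (z i)) (hB : ∀ i, z (i + 2) ≠ z i) :
    ∀ i j : ℤ, c * |((i : ℝ) - j)| ≤ dist (z i) (z j) := by
  have key : ∀ (i : ℤ) (k : ℕ), c * k ≤ dist (z i) (z (i + k)) := by
    intro i k
    have h1 : ∀ n : ℕ, z (i + ((n + 1 : ℕ) : ℤ)) ∈ FB (z (i + n)) := fun n => by
      have := hS (i + n)
      rwa [show i + (n : ℤ) + 1 = i + ((n + 1 : ℕ) : ℤ) by omega] at this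
    have h2 : ∀ n : ℕ, z (i + ((n + 2 : ℕ) : ℤ)) ≠ z (i + n) := fun n => by
      have := hB (i + n)
      rwa [show i + (n : ℤ) + 2 = i + ((n + 2 : ℕ) : ℤ) by omega] at this
    have h := hQ (fun n : ℕ => z (i + n)) (fun n => hY _) h1 h2 0 k
    simpa using h
  intro i j
  rcases le_total i j with h | h
  · obtain ⟨k, rfl⟩ := Int.le.dest h
    have e : |((i : ℤ) : ℝ) - ((i + (k : ℤ) : ℤ) : ℝ)| = k := by
      push_cast
      rw [sub_add_cancel_left, abs_neg, Nat.abs_cast]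
    rw [e]
    exact key i k
  · obtain ⟨k, rfl⟩ := Int.le.dest h
    have e : |((j + (k : ℤ) : ℤ) : ℝ) - ((j : ℤ) : ℝ)| = k := by
      push_cast
      rw [add_sub_cancel_left, Nat.abs_cast]
    rw [e, dist_comm]
    exact key j k

/-- **Walks stay on the chain.** If `FB` is symmetric on `Y` and takes at every site of `Y` no value
or exactly two, then along a bi-infinite non-backtracking `FB`-chain `z` the partners of `z i` are
exactly `z (i - 1) ≠ z (i + 1)`, so every `FB`-walk starting at `z 0` stays in `range z`. [folklore] -/
theorem ffrFG_range {E : Type*} (Y : Set E) (FB : E → Set E)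
    (hsymm : ∀ y ∈ Y, ∀ v, v ∈ FB y → y ∈ FB v) (hN : ∀ y ∈ Y, FB y = ∅ ∨ (FB y).ncard = 2)
    {z : ℤ → E} (hY : ∀ i, z i ∈ Y) (hS : ∀ i, z (i + 1) ∈ FB (z i)) (hB : ∀ i, z (i + 2) ≠ z i)
    {h : ℕ → E} (h0 : h 0 = z 0) (hstep : ∀ n, h (n + 1) ∈ FB (h n)) :
    ∀ n, h n ∈ Set.range z := by
  intro n
  induction n with
  | zero => exact ⟨0, h0.symm⟩
  | succ n ih =>
    obtain ⟨i, hi⟩ := ih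
    have hmem : h (n + 1) ∈ FB (z i) := by
      rw [hi]
      exact hstep n
    have hup : z (i + 1) ∈ FB (z i) := hS i
    have hdown : z (i - 1) ∈ FB (z i) := by
      have := hS (i - 1)
      rw [sub_add_cancel] at this
      exact hsymm _ (hY _) _ this
    have hne : z (i + 1) ≠ z (i - 1) := by
      have := hB (i - 1)
      rwa [show i - 1 + 2 = i + 1 by ring] at this
    have h2 : (FB (z i)).ncard = 2 := by
      rcases hN (z i) (hY i) with h0' | h2
      · rw [h0'] at hup
        exact absurd hup (Set.notMem_empty _)
      · exact h2
    -- `FB (z i) = {x, y}` contains the distinct `z (i + 1)`, `z (i - 1)`, and `h (n + 1)`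
    obtain ⟨x, y, _, hxy⟩ := Set.ncard_eq_two.1 h2
    rw [hxy, Set.mem_insert_iff, Set.mem_singleton_iff] at hup hdown hmem
    rcases hup with hu | hu <;> rcases hdown with hd | hd
    · exact absurd (hu.trans hd.symm) hne
    · rcases hmem with hm | hm
      · exact ⟨i + 1, by rw [hu, hm]⟩
      · exact ⟨i - 1, by rw [hd, hm]⟩
    · rcases hmem with hm | hm
      · exact ⟨i - 1, by rw [hd, hm]⟩
      · exact ⟨i + 1, by rw [hu, hm]⟩
    · exact absurd (hu.trans hd.symm) hne

/-- **The abstract gluing theorem.** `FB` a partner map, symmetric on `Y`, with partners at distance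
`≤ B`, no branching, non-backtracking walks out of every partner pair, axis uniqueness on the set `S`
of sites with a partner, and uniform quasi-geodesy of non-backtracking walks: then `S` is empty or the
range of one bi-infinite quasi-geodesic `FB`-chain. [folklore] -/
theorem ffrFG_main {E : Type*} [PseudoMetricSpace E] (Y : Set E) (FB : E → Set E) (S : Set E)
    (B : ℝ) (hS : ∀ y, y ∈ S ↔ y ∈ Y ∧ ∃ v, v ∈ FB y)
    (hsymm : ∀ y ∈ Y, ∀ v, v ∈ FB y → y ∈ FB v) (hbond : ∀ y v, v ∈ FB y → dist y v ≤ B)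
    (hN : ∀ y ∈ Y, FB y = ∅ ∨ (FB y).ncard = 2)
    (hW : ∀ y₀ ∈ Y, ∀ v₀ ∈ FB y₀, ∃ f : ℕ → E, f 0 = y₀ ∧ f 1 = v₀ ∧ (∀ n, f n ∈ Y) ∧
      (∀ n, f (n + 1) ∈ FB (f n)) ∧ (∀ n, f (n + 2) ≠ f n))
    (hU : ∀ y ∈ S, ∀ y' ∈ S, ∃ f : ℕ → E, f 0 = y ∧ (∀ n, f n ∈ Y) ∧
      (∀ n, f (n + 1) ∈ FB (f n)) ∧ ∃ n, f n = y')
    (hQ : ∃ c : ℝ, 0 < c ∧ ∀ f : ℕ → E, (∀ n, f n ∈ Y) → (∀ n, f (n + 1) ∈ FB (f n)) →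
      (∀ n, f (n + 2) ≠ f n) → ∀ i j : ℕ, c * |((i : ℝ) - j)| ≤ dist (f i) (f j)) :
    S = ∅ ∨ ∃ (z : ℤ → E) (c : ℝ), 0 < c ∧ (∀ i, z i ∈ Y) ∧ (∀ i, dist (z i) (z (i + 1)) ≤ B) ∧
      (∀ i j : ℤ, c * |((i : ℝ) - j)| ≤ dist (z i) (z j)) ∧ S = Set.range z := by
  rcases Set.eq_empty_or_nonempty S with hS0 | ⟨y₀, hy₀⟩
  · exact Or.inl hS0
  right
  obtain ⟨hy₀Y, v, hv⟩ := (hS y₀).1 hy₀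
  have h2 : (FB y₀).ncard = 2 := by
    rcases hN y₀ hy₀Y with h0 | h2
    · rw [h0] at hv
      exact absurd hv (Set.notMem_empty _)
    · exact h2
  obtain ⟨v₀, v₁, hne, hFB⟩ := Set.ncard_eq_two.1 h2
  have hv₀ : v₀ ∈ FB y₀ := by
    rw [hFB]
    exact Set.mem_insert _ _
  have hv₁ : v₁ ∈ FB y₀ := by
    rw [hFB]
    exact Set.mem_insert_of_mem _ (Set.mem_singleton _)
  obtain ⟨fp, hp0, hp1, hpY, hpS, hpB⟩ := hW y₀ hy₀Y v₀ hv₀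
  obtain ⟨fm, hm0, hm1, hmY, hmS, hmB⟩ := hW y₀ hy₀Y v₁ hv₁
  obtain ⟨z, hz0, hzY, hzS, hzB⟩ := ffrFG_chain Y FB hsymm (hp0.trans hm0.symm)
    (by rw [hp1, hm1]; exact hne) hpY hpS hpB hmY hmS hmB
  obtain ⟨c, hc, hcq⟩ := hQ
  refine ⟨z, c, hc, hzY, fun i => hbond _ _ (hzS i), ffrFG_quasi Y FB hcq hzY hzS hzB, ?_⟩
  ext y
  constructor
  · intro hy
    obtain ⟨f, hf0, _, hfS, n, hfn⟩ := hU y₀ hy₀ y hy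
    rw [← hfn]
    exact ffrFG_range Y FB hsymm hN hzY hzS hzB (by rw [hf0, hz0, hp0]) hfS n
  · rintro ⟨i, rfl⟩
    exact (hS _).2 ⟨hzY i, z (i + 1), hzS i⟩

/-- **Stub F-glue (provable now).** No branching + walks + axis uniqueness + uniform quasi-geodesy ⇒ the
five-sites are empty or the range of ONE bi-infinite bond chain `z : ℤ → Y` with `c·|i − j| ≤ dist (z i) (z j)`:
glue the two walks out of a five-site `y₀` (towards its two poles) into `z`; `z (i ± 1)` are two distinct
five-bond partners of `z i`, which has exactly two, so every five-fold walk from `y₀` stays in `range z`.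
[folklore] -/
theorem stub_ffrFoamGlue :
    ∀ (Y : Set (EuclideanSpace ℝ (Fin 3))) (a : ℝ), 0 < a →
      (∀ y ∈ Y, {v ∈ Y | v ≠ y ∧ dist y v ≤ a * (1 + 1 / 50) ∧
          5 ≤ {w ∈ Y | w ≠ y ∧ w ≠ v ∧ dist y w ≤ a * (1 + 1 / 50) ∧
            dist v w ≤ a * (1 + 1 / 50)}.ncard} = ∅ ∨
        ({v ∈ Y | v ≠ y ∧ dist y v ≤ a * (1 + 1 / 50) ∧
          5 ≤ {w ∈ Y | w ≠ y ∧ w ≠ v ∧ dist y w ≤ a * (1 + 1 / 50) ∧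
            dist v w ≤ a * (1 + 1 / 50)}.ncard}).ncard = 2) →
      (∀ y₀ ∈ Y, ∀ v₀ ∈ {v ∈ Y | v ≠ y₀ ∧ dist y₀ v ≤ a * (1 + 1 / 50) ∧
          5 ≤ {w ∈ Y | w ≠ y₀ ∧ w ≠ v ∧ dist y₀ w ≤ a * (1 + 1 / 50) ∧
            dist v w ≤ a * (1 + 1 / 50)}.ncard},
        ∃ f : ℕ → EuclideanSpace ℝ (Fin 3), f 0 = y₀ ∧ f 1 = v₀ ∧ (∀ n, f n ∈ Y) ∧
          (∀ n, f (n + 1) ∈ {v ∈ Y | v ≠ (f n) ∧ dist (f n) v ≤ a * (1 + 1 / 50) ∧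
          5 ≤ {w ∈ Y | w ≠ (f n) ∧ w ≠ v ∧ dist (f n) w ≤ a * (1 + 1 / 50) ∧
            dist v w ≤ a * (1 + 1 / 50)}.ncard}) ∧
          (∀ n, f (n + 2) ≠ f n)) →
      (∀ y ∈ {y ∈ Y | ∃ v ∈ Y, v ≠ y ∧ dist y v ≤ a * (1 + 1 / 50) ∧
          5 ≤ {w ∈ Y | w ≠ y ∧ w ≠ v ∧ dist y w ≤ a * (1 + 1 / 50) ∧
            dist v w ≤ a * (1 + 1 / 50)}.ncard},
        ∀ y' ∈ {y ∈ Y | ∃ v ∈ Y, v ≠ y ∧ dist y v ≤ a * (1 + 1 / 50) ∧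
          5 ≤ {w ∈ Y | w ≠ y ∧ w ≠ v ∧ dist y w ≤ a * (1 + 1 / 50) ∧
            dist v w ≤ a * (1 + 1 / 50)}.ncard},
        ∃ f : ℕ → EuclideanSpace ℝ (Fin 3), f 0 = y ∧ (∀ n, f n ∈ Y) ∧
          (∀ n, f (n + 1) ∈ {v ∈ Y | v ≠ (f n) ∧ dist (f n) v ≤ a * (1 + 1 / 50) ∧
          5 ≤ {w ∈ Y | w ≠ (f n) ∧ w ≠ v ∧ dist (f n) w ≤ a * (1 + 1 / 50) ∧
            dist v w ≤ a * (1 + 1 / 50)}.ncard}) ∧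
          ∃ n, f n = y') →
      (∃ c : ℝ, 0 < c ∧ ∀ f : ℕ → EuclideanSpace ℝ (Fin 3), (∀ n, f n ∈ Y) →
        (∀ n, f (n + 1) ∈ {v ∈ Y | v ≠ (f n) ∧ dist (f n) v ≤ a * (1 + 1 / 50) ∧
          5 ≤ {w ∈ Y | w ≠ (f n) ∧ w ≠ v ∧ dist (f n) w ≤ a * (1 + 1 / 50) ∧
            dist v w ≤ a * (1 + 1 / 50)}.ncard}) →
        (∀ n, f (n + 2) ≠ f n) → ∀ i j : ℕ, c * |((i : ℝ) - j)| ≤ dist (f i) (f j)) →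
      ({y ∈ Y | ∃ v ∈ Y, v ≠ y ∧ dist y v ≤ a * (1 + 1 / 50) ∧
          5 ≤ {w ∈ Y | w ≠ y ∧ w ≠ v ∧ dist y w ≤ a * (1 + 1 / 50) ∧
            dist v w ≤ a * (1 + 1 / 50)}.ncard} = ∅ ∨
        ∃ (z : ℤ → EuclideanSpace ℝ (Fin 3)) (c : ℝ), 0 < c ∧ (∀ i, z i ∈ Y) ∧
          (∀ i, dist (z i) (z (i + 1)) ≤ a * (1 + 1 / 50)) ∧
          (∀ i j : ℤ, c * |((i : ℝ) - j)| ≤ dist (z i) (z j)) ∧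
          {y ∈ Y | ∃ v ∈ Y, v ≠ y ∧ dist y v ≤ a * (1 + 1 / 50) ∧
          5 ≤ {w ∈ Y | w ≠ y ∧ w ≠ v ∧ dist y w ≤ a * (1 + 1 / 50) ∧
            dist v w ≤ a * (1 + 1 / 50)}.ncard} = Set.range z) := by
  intro Y a _ hN hW hU hQ
  refine ffrFG_main Y
    (fun y => {v ∈ Y | v ≠ y ∧ dist y v ≤ a * (1 + 1 / 50) ∧
      5 ≤ {w ∈ Y | w ≠ y ∧ w ≠ v ∧ dist y w ≤ a * (1 + 1 / 50) ∧
        dist v w ≤ a * (1 + 1 / 50)}.ncard})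
    {y ∈ Y | ∃ v ∈ Y, v ≠ y ∧ dist y v ≤ a * (1 + 1 / 50) ∧
      5 ≤ {w ∈ Y | w ≠ y ∧ w ≠ v ∧ dist y w ≤ a * (1 + 1 / 50) ∧
        dist v w ≤ a * (1 + 1 / 50)}.ncard}
    (a * (1 + 1 / 50)) (fun _ => Iff.rfl) ?_ ?_ hN hW hU hQ
  · -- the five-bond relation is symmetric
    intro y hy v hv
    obtain ⟨_, hvy, hd, h5⟩ := hv
    refine ⟨hy, fun h => hvy h.symm, ?_, ?_⟩
    · rw [dist_comm]
      exact hd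
    · have hset : {w ∈ Y | w ≠ v ∧ w ≠ y ∧ dist v w ≤ a * (1 + 1 / 50) ∧
          dist y w ≤ a * (1 + 1 / 50)} = {w ∈ Y | w ≠ y ∧ w ≠ v ∧ dist y w ≤ a * (1 + 1 / 50) ∧
          dist v w ≤ a * (1 + 1 / 50)} := by
        ext w
        simp only [Set.mem_setOf_eq]
        tauto
      show 5 ≤ {w ∈ Y | w ≠ v ∧ w ≠ y ∧ dist v w ≤ a * (1 + 1 / 50) ∧
          dist y w ≤ a * (1 + 1 / 50)}.ncard
      rw [hset]
      exact h5
  · -- five-bond partners are bond partners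
    intro y v hv
    exact hv.2.2.1

end Summit.AtomisticToContinuum.Crystallization.Theorems

end
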